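import Summits.RiemannHypothesis.RiemannHypothesis.Theorems.TwoPrimeFoldRigidity.Negative.MBTBudget

/-!
# One-lattice moment-blind towers, part 6: assembly and the existence theorem

HONEST LABEL.  Negative-side helper toward `¬ IntegerScrew.TwoPrimeFoldRigidity` (item stmt-RiemannHypothesis-25784);
record-negative programme; 0 toward RH.  RH is not proved, not used, not mentioned below.
Nothing here bears on the truth of RH.

THEOREM (`momentBlindTower_exists`).  For every step `h > 0` there is a nonempty, locally finite family of exponents
`κ_i` with `0 < Re κ_i < 1/4`, `Im κ_i > 1`, and weights `μ_i > 0` with `Σ μ_i |κ_i|² < ∞`, such that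
`Σ_i μ_i conj(κ_i)^r e^{κ_i k h} = 0` for every integer `k ≥ 1` and `r = 0, 1, 2`.  With
`TensorReduction.twoPrimeFoldRigidity_false_of_towers` (towers for `log 2` and `log 3`) this refutes
`IntegerScrew.TwoPrimeFoldRigidity` (the refutation file is `Theorems/IntegerScrewTwoPrimeFoldRigidityRefutation.lean`).
Masses of level `m` are `≤ C/(m+1)²`; at time `kh` a level is invisible unless `n_m ∣ k`, and for `k = K₀(M+1)` the
visible levels `M`, `D M` contribute `e^{Akh}(Φ_M(1) + R_M) = 0`.
-/

set_option linter.dupNamespace false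

noncomputable section

open scoped ComplexConjugate
open Complex Finset

namespace Summit.RiemannHypothesis.RiemannHypothesis.Theorems.TwoPrimeFoldRigidity.Negative.MBT

namespace Prm

variable (p : Prm)

/-! ## §7 Assembly of the tower -/

/-- the tower is nonempty. -/
theorem idx_nonempty : Nonempty p.Idx :=
  ⟨⟨0, Sum.inl 0, (⟨0, p.nn_pos 0⟩, ⟨0, p.nn_pos 0⟩, ⟨0, p.nn_pos 0⟩)⟩⟩

/-- weights are positive. -/
theorem wt_pos (i : p.Idx) : 0 < p.wt i := by
  unfold wt; have := p.amp_pos i.1 i.2.1; have := p.nn_real_pos i.1; positivity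

/-- real parts of the exponents are the level abscissae. -/
theorem kap_re (i : p.Idx) : (p.kap i).re = p.σ i.1 := p.re_atom _ _ _

/-- real parts are positive. -/
theorem kap_re_pos (i : p.Idx) : 0 < (p.kap i).re := by rw [kap_re]; exact p.σ_pos _

/-- real parts stay strictly below `A`. -/
theorem kap_re_lt (i : p.Idx) : (p.kap i).re < p.A := by rw [kap_re]; exact p.σ_lt _

/-- heights of level `m` are at least `m + 1`. -/
theorem succ_le_kap_im (i : p.Idx) : (i.1 : ℝ) + 1 ≤ (p.kap i).im :=
  (p.succ_le_Γ i.1).trans (p.Γ_le_im_atom _ _ _)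

/-- heights exceed `1`. -/
theorem one_lt_kap_im (i : p.Idx) : 1 < (p.kap i).im := (p.one_lt_Γ i.1).trans_le (p.Γ_le_im_atom _ _ _)

/-- exponents have modulus `≥ 1`. -/
theorem one_le_norm_kap (i : p.Idx) : 1 ≤ ‖p.kap i‖ :=
  (p.one_lt_kap_im i).le.trans ((le_abs_self _).trans (Complex.abs_im_le_norm _))

/-- exponents of level `m` have modulus `≤ 15Γ_m`. -/
theorem norm_kap_le (i : p.Idx) : ‖p.kap i‖ ≤ 15 * p.Γ i.1 := p.norm_atom_le _ _ _

/-- local finiteness of the heights. -/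
theorem im_finite (T : ℝ) : {i : p.Idx | (p.kap i).im ≤ T}.Finite := by
  refine (((Finset.range ⌈T⌉₊).sigma fun m ↦ (Finset.univ : Finset (G × p.Cube m))).finite_toSet).subset ?_
  intro i hi
  simp only [Set.mem_setOf_eq] at hi
  rw [Finset.mem_coe, Finset.mem_sigma]
  refine ⟨Finset.mem_range.mpr (Nat.lt_ceil.mpr ?_), Finset.mem_univ _⟩
  have := p.succ_le_kap_im i
  linarith

/-- size of the cube of level `m`. -/
theorem card_cube (m : ℕ) : Fintype.card (p.Cube m) = p.nn m * (p.nn m * p.nn m) := by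
  simp [Fintype.card_prod, Fintype.card_fin]

/-- second-moment mass of one level: `≤ 225 e^{20} Γ_m² E_m`. -/
theorem level_mass_le (m : ℕ) :
    ∑ a : G × p.Cube m, p.wt ⟨m, a⟩ * ‖p.kap ⟨m, a⟩‖ ^ 2 ≤ 225 * Real.exp 20 * p.Γ m ^ 2 * p.E m := by
  have hn := p.nn_real_pos m
  have h1 : ∀ a : G × p.Cube m, p.wt ⟨m, a⟩ * ‖p.kap ⟨m, a⟩‖ ^ 2 ≤
      p.amp m a.1 * (Real.exp 20 * (15 * p.Γ m) ^ 2) / (p.nn m : ℝ) ^ 3 := by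
    intro a
    have hw := (p.wt_pos ⟨m, a⟩).le
    have hk := p.norm_kap_le ⟨m, a⟩
    have := p.amp_pos m a.1
    calc p.wt ⟨m, a⟩ * ‖p.kap ⟨m, a⟩‖ ^ 2 ≤ p.wt ⟨m, a⟩ * (15 * p.Γ m) ^ 2 := by
          exact mul_le_mul_of_nonneg_left (pow_le_pow_left₀ (norm_nonneg _) hk 2) hw
      _ = p.amp m a.1 * (Real.exp 20 * (15 * p.Γ m) ^ 2) / (p.nn m : ℝ) ^ 3 := by
          simp only [wt]; ring
  refine (Finset.sum_le_sum fun a _ ↦ h1 a).trans ?_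
  rw [Fintype.sum_prod_type]
  simp only [Finset.sum_const, Finset.card_univ, card_cube, nsmul_eq_mul]
  push_cast
  have e : ∀ g : G, (p.nn m : ℝ) * ((p.nn m : ℝ) * (p.nn m : ℝ)) *
      (p.amp m g * (Real.exp 20 * (15 * p.Γ m) ^ 2) / (p.nn m : ℝ) ^ 3) =
      225 * Real.exp 20 * p.Γ m ^ 2 * p.amp m g := by
    intro g; field_simp; ring
  simp only [e, ← Finset.mul_sum]
  rfl

/-- `Γ_m = (2πK₀P₀/h)(m+1)`. -/
theorem Γ_formula (m : ℕ) : p.Γ m = (2 * Real.pi * p.K₀ * p.P₀ / p.h) * (((m + 1 : ℕ)) : ℝ) := by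
  simp only [Γ, nn]; push_cast; ring

/-- summability of the second-moment mass `Σ wt · |κ|²`. -/
theorem mass_summable : Summable (fun i : p.Idx ↦ p.wt i * ‖p.kap i‖ ^ 2) := by
  have hnn : ∀ i : p.Idx, 0 ≤ p.wt i * ‖p.kap i‖ ^ 2 := fun i ↦ by have := p.wt_pos i; positivity
  rw [summable_sigma_of_nonneg hnn]
  refine ⟨fun m ↦ (hasSum_fintype _).summable, ?_⟩
  simp_rw [tsum_fintype]
  set C := 225 * Real.exp 20 * (2 * Real.pi * p.K₀ * p.P₀ / p.h) ^ 2 * 2000000 with hC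
  have hs : Summable (fun m : ℕ ↦ C * (1 / ((m + 1 : ℕ) : ℝ) ^ 2)) :=
    ((summable_nat_add_iff 1).mpr (Real.summable_one_div_nat_pow.mpr one_lt_two)).mul_left C
  refine Summable.of_nonneg_of_le (fun m ↦ Finset.sum_nonneg fun a _ ↦ hnn ⟨m, a⟩) (fun m ↦ ?_) hs
  refine (p.level_mass_le m).trans ?_
  have h1 := p.E_le m
  have h2 : p.Γ m ^ 2 * f m = (2 * Real.pi * p.K₀ * p.P₀ / p.h) ^ 2 * (1 / ((m + 1 : ℕ) : ℝ) ^ 2) := by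
    rw [p.Γ_formula m]; unfold f
    have : (0 : ℝ) < ((m + 1 : ℕ) : ℝ) := by positivity
    push_cast
    field_simp
  have h3 : 0 ≤ 225 * Real.exp 20 * p.Γ m ^ 2 := by positivity
  calc 225 * Real.exp 20 * p.Γ m ^ 2 * p.E m ≤ 225 * Real.exp 20 * p.Γ m ^ 2 * (2000000 * f m) :=
        mul_le_mul_of_nonneg_left h1 h3
    _ = 225 * Real.exp 20 * 2000000 * (p.Γ m ^ 2 * f m) := by ring
    _ = C * (1 / ((m + 1 : ℕ) : ℝ) ^ 2) := by rw [h2, hC]; ring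

/-- a level whose order does not divide the time is invisible (moments `r ≤ 2`). -/
theorem fiber_zero (m k : ℕ) (hk : ¬ p.nn m ∣ k) (r : ℕ) (hr : r ≤ 2) :
    ∑ a : G × p.Cube m, (p.wt ⟨m, a⟩ : ℂ) * conj (p.kap ⟨m, a⟩) ^ r *
        Complex.exp (p.kap ⟨m, a⟩ * (((k : ℝ) * p.h : ℝ) : ℂ)) = 0 := by
  rw [Fintype.sum_prod_type]
  refine Finset.sum_eq_zero fun g _ ↦ ?_
  simp only [wt, kap]
  have h0 := gon_sum_eq_zero (p.σ m) (p.β m) (p.γ m g) p.h p.hh.ne' (p.nn_ne_zero m) rfl hk hr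
  simp_rw [mul_assoc]
  rw [← Finset.mul_sum, h0, mul_zero]

/-- a level at the `j'`-th multiple of its order shows `e^{A t} Φ`. -/
theorem fiber_eq (m j' k : ℕ) (hk : k = j' * p.nn m) (r : ℕ) :
    ∑ a : G × p.Cube m, (p.wt ⟨m, a⟩ : ℂ) * conj (p.kap ⟨m, a⟩) ^ r *
        Complex.exp (p.kap ⟨m, a⟩ * (((k : ℝ) * p.h : ℝ) : ℂ)) =
      ((Real.exp (p.A * ((k : ℝ) * p.h)) : ℝ) : ℂ) * p.Φ (p.amp m) m j' r := by
  subst hk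
  rw [Fintype.sum_prod_type]
  unfold Φ
  rw [Finset.mul_sum]
  refine Finset.sum_congr rfl fun g _ ↦ ?_
  simp only [wt, kap]
  simp_rw [mul_assoc]
  rw [← Finset.mul_sum, gon_sum_multiple (p.σ m) (p.β m) (p.γ m g) p.h p.hh.ne' (p.nn_ne_zero m) rfl j' r,
    p.exp_base_mul m g j']
  have hn : (p.nn m : ℝ) ≠ 0 := (p.nn_real_pos m).ne'
  have hex : Real.exp 20 * Real.exp (p.σ m * ((((j' * p.nn m : ℕ)) : ℝ) * p.h)) =
      Real.exp (p.A * ((((j' * p.nn m : ℕ)) : ℝ) * p.h)) * Real.exp (-(20 * ((j' : ℝ) - 1))) := by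
    rw [← Real.exp_add, ← Real.exp_add]
    congr 1
    have := p.σ_mul m
    push_cast
    linear_combination (j' : ℝ) * this
  have keyR : p.amp m g * Real.exp 20 / (p.nn m : ℝ) ^ 3 * Real.exp (p.σ m * ((((j' * p.nn m : ℕ)) : ℝ) * p.h)) *
      (p.nn m : ℝ) ^ 3 = Real.exp (p.A * ((((j' * p.nn m : ℕ)) : ℝ) * p.h)) *
        (p.amp m g * Real.exp (-(20 * ((j' : ℝ) - 1)))) := by
    rw [div_mul_eq_mul_div, div_mul_cancel₀ _ (pow_ne_zero 3 hn)]
    linear_combination p.amp m g * hex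
  have keyC : ((p.amp m g * Real.exp 20 / (p.nn m : ℝ) ^ 3 : ℝ) : ℂ) *
      ((Real.exp (p.σ m * ((((j' * p.nn m : ℕ)) : ℝ) * p.h)) : ℝ) : ℂ) * ((p.nn m : ℂ) ^ 3) =
      ((Real.exp (p.A * ((((j' * p.nn m : ℕ)) : ℝ) * p.h)) : ℝ) : ℂ) *
        ((p.amp m g : ℂ) * ((Real.exp (-(20 * ((j' : ℝ) - 1))) : ℝ) : ℂ)) := by
    have := congrArg (fun x : ℝ ↦ (x : ℂ)) keyR
    push_cast at this ⊢
    exact this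
  simp only [W]
  calc ((p.amp m g * Real.exp 20 / (p.nn m : ℝ) ^ 3 : ℝ) : ℂ) *
        (((Real.exp (p.σ m * ((((j' * p.nn m : ℕ)) : ℝ) * p.h)) : ℝ) : ℂ) * I ^ (p.Qn m g * j') *
          ((p.nn m : ℂ) ^ 3 * Wm (p.nn m) (p.σ m) (p.β m) (p.γ m g) r))
      = (((p.amp m g * Real.exp 20 / (p.nn m : ℝ) ^ 3 : ℝ) : ℂ) *
          ((Real.exp (p.σ m * ((((j' * p.nn m : ℕ)) : ℝ) * p.h)) : ℝ) : ℂ) * ((p.nn m : ℂ) ^ 3)) *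
          (I ^ (p.Qn m g * j') * Wm (p.nn m) (p.σ m) (p.β m) (p.γ m g) r) := by ring
    _ = ((Real.exp (p.A * ((((j' * p.nn m : ℕ)) : ℝ) * p.h)) : ℝ) : ℂ) *
        ((p.amp m g : ℂ) * ((Real.exp (-(20 * ((j' : ℝ) - 1))) : ℝ) : ℂ)) *
          (I ^ (p.Qn m g * j') * Wm (p.nn m) (p.σ m) (p.β m) (p.γ m g) r) := by rw [keyC]
    _ = _ := by ring

/-- which levels are visible at time `k = K₀ (M+1)`: exactly `M` and `D M`. -/
theorem not_dvd_of_not_mem {M m : ℕ} (hm : m ∉ insert M (D M)) : ¬ p.nn m ∣ p.nn M := by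
  intro h
  simp only [nn] at h
  have h1 : (m + 1) ∣ (M + 1) := Nat.dvd_of_mul_dvd_mul_left p.K₀_pos h
  have h2 : m + 1 ≤ M + 1 := Nat.le_of_dvd (Nat.succ_pos M) h1
  apply hm
  rw [Finset.mem_insert]
  rcases Nat.lt_or_eq_of_le (Nat.le_of_succ_le_succ h2) with h3 | h3
  · right; simp [D, h3, h1]
  · left; exact h3

/-- **lattice blindness of the tower**: all moments `r ≤ 2` vanish at every time `k h`, `k ≥ 1`. -/
theorem blind (k : ℕ) (hk : 1 ≤ k) (r : ℕ) (hr : r ≤ 2) :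
    HasSum (fun i : p.Idx ↦ (p.wt i : ℂ) * conj (p.kap i) ^ r *
      Complex.exp (p.kap i * (((k : ℝ) * p.h : ℝ) : ℂ))) 0 := by
  have ht : 0 ≤ (k : ℝ) * p.h := by have := p.hh; positivity
  -- absolute summability
  have hsum : Summable (fun i : p.Idx ↦ (p.wt i : ℂ) * conj (p.kap i) ^ r *
      Complex.exp (p.kap i * (((k : ℝ) * p.h : ℝ) : ℂ))) := by
    refine Summable.of_norm_bounded ((p.mass_summable).mul_left (Real.exp (p.A * ((k : ℝ) * p.h))))
      fun i ↦ ?_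
    rw [norm_mul, norm_mul, norm_pow, Complex.norm_conj, Complex.norm_real, Real.norm_of_nonneg (p.wt_pos i).le,
      Complex.norm_exp]
    have hre : (p.kap i * (((k : ℝ) * p.h : ℝ) : ℂ)).re = (p.kap i).re * ((k : ℝ) * p.h) := by
      rw [Complex.mul_re, Complex.ofReal_re, Complex.ofReal_im, mul_zero, sub_zero]
    rw [hre]
    have h1 : ‖p.kap i‖ ^ r ≤ ‖p.kap i‖ ^ 2 := pow_le_pow_right₀ (p.one_le_norm_kap i) hr
    have h2 : Real.exp ((p.kap i).re * ((k : ℝ) * p.h)) ≤ Real.exp (p.A * ((k : ℝ) * p.h)) :=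
      Real.exp_le_exp.mpr (mul_le_mul_of_nonneg_right (p.kap_re_lt i).le ht)
    have := p.wt_pos i
    calc p.wt i * ‖p.kap i‖ ^ r * Real.exp ((p.kap i).re * ((k : ℝ) * p.h))
        ≤ p.wt i * ‖p.kap i‖ ^ 2 * Real.exp (p.A * ((k : ℝ) * p.h)) := by gcongr
      _ = Real.exp (p.A * ((k : ℝ) * p.h)) * (p.wt i * ‖p.kap i‖ ^ 2) := by ring
  have hfib := hsum.hasSum.sigma (fun m ↦ hasSum_fintype (fun a : G × p.Cube m ↦
    (p.wt ⟨m, a⟩ : ℂ) * conj (p.kap ⟨m, a⟩) ^ r * Complex.exp (p.kap ⟨m, a⟩ * (((k : ℝ) * p.h : ℝ) : ℂ))))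
  by_cases hK : p.K₀ ∣ k
  · obtain ⟨k₁, hk₁⟩ := hK
    have hk₁pos : 1 ≤ k₁ := by
      rcases Nat.eq_zero_or_pos k₁ with h0 | h0
      · subst h0; simp at hk₁; omega
      · exact h0
    obtain ⟨M, rfl⟩ : ∃ M, k₁ = M + 1 := ⟨k₁ - 1, by omega⟩
    have hkM : k = p.nn M := by simp [nn, hk₁]
    have hfin : HasSum (fun m ↦ ∑ a : G × p.Cube m, (p.wt ⟨m, a⟩ : ℂ) * conj (p.kap ⟨m, a⟩) ^ r *
        Complex.exp (p.kap ⟨m, a⟩ * (((k : ℝ) * p.h : ℝ) : ℂ)))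
        (∑ m ∈ insert M (D M), ∑ a : G × p.Cube m, (p.wt ⟨m, a⟩ : ℂ) * conj (p.kap ⟨m, a⟩) ^ r *
          Complex.exp (p.kap ⟨m, a⟩ * (((k : ℝ) * p.h : ℝ) : ℂ))) :=
      hasSum_sum_of_ne_finset_zero (fun m hm ↦ by
          apply p.fiber_zero m k _ r hr
          rw [hkM]; exact p.not_dvd_of_not_mem hm)
    have heq := hfib.unique hfin
    have hzero : ∑ m ∈ insert M (D M), ∑ a : G × p.Cube m, (p.wt ⟨m, a⟩ : ℂ) * conj (p.kap ⟨m, a⟩) ^ r *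
        Complex.exp (p.kap ⟨m, a⟩ * (((k : ℝ) * p.h : ℝ) : ℂ)) = 0 := by
      have hM : M ∉ D M := by simp [D]
      rw [Finset.sum_insert hM]
      rw [p.fiber_eq M 1 k (by rw [hkM, one_mul]) r, p.Φ_amp_one M r hr]
      have hrest : ∀ m' ∈ D M, ∑ a : G × p.Cube m', (p.wt ⟨m', a⟩ : ℂ) * conj (p.kap ⟨m', a⟩) ^ r *
          Complex.exp (p.kap ⟨m', a⟩ * (((k : ℝ) * p.h : ℝ) : ℂ)) =
          ((Real.exp (p.A * ((k : ℝ) * p.h)) : ℝ) : ℂ) * p.Φ (p.amp m') m' ((M + 1) / (m' + 1)) r := by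
        intro m' hm'
        obtain ⟨_, hd⟩ := mem_D hm'
        refine p.fiber_eq m' _ k ?_ r
        rw [hkM]; simp only [nn]
        rw [Nat.mul_comm ((M + 1) / (m' + 1)), Nat.mul_assoc, Nat.mul_comm (m' + 1), Nat.div_mul_cancel hd]
      rw [Finset.sum_congr rfl hrest, ← Finset.mul_sum]
      unfold R
      ring
    rw [hzero] at heq
    rw [← heq]
    exact hsum.hasSum
  · have hfin : HasSum (fun m ↦ ∑ a : G × p.Cube m, (p.wt ⟨m, a⟩ : ℂ) * conj (p.kap ⟨m, a⟩) ^ r *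
        Complex.exp (p.kap ⟨m, a⟩ * (((k : ℝ) * p.h : ℝ) : ℂ)))
        (∑ m ∈ (∅ : Finset ℕ), ∑ a : G × p.Cube m, (p.wt ⟨m, a⟩ : ℂ) * conj (p.kap ⟨m, a⟩) ^ r *
          Complex.exp (p.kap ⟨m, a⟩ * (((k : ℝ) * p.h : ℝ) : ℂ))) :=
      hasSum_sum_of_ne_finset_zero (fun m _ ↦ by
          apply p.fiber_zero m k _ r hr
          intro h
          exact hK (dvd_trans (Dvd.intro (m + 1) rfl) h))
    rw [Finset.sum_empty] at hfin
    have heq := hfib.unique hfin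
    rw [← heq]
    exact hsum.hasSum

end Prm

/-! ## §8 The theorem -/

/-- **One-lattice moment-blind towers exist** (for every step `h > 0`, inside `0 < Re κ < 1/4`):
a locally finite configuration of exponents `κ_i` (`Im κ_i > 1`) with weights `μ_i > 0` and
`Σ μ_i |κ_i|² < ∞` whose moment sums `Σ_i μ_i conj(κ_i)^r e^{κ_i k h}` vanish for every integer
`k ≥ 1` and `r = 0, 1, 2`.  Mechanism: levels of eleven "cubed gons" (orders `K₀(m+1)`, abscissae
`σ_m ↑ 1/4` not attained), each level cancelling — by an explicit six-unknown solve on two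
phase-conjugate quintuples plus a forcing gon — the spill of the earlier dividing levels at its own
time; the spill decays like `e^{-20(j-1)}` so the amplitudes obey `E_m = O((m+1)⁻⁴)`. -/
theorem momentBlindTower_exists (h : ℝ) (hh : 0 < h) :
    ∃ (ι : Type) (μ : ι → ℝ) (κ : ι → ℂ), Nonempty ι ∧ (∀ i, 0 < μ i) ∧
      (∀ i, 0 < (κ i).re ∧ (κ i).re < 1 / 4) ∧ (∀ i, 1 < (κ i).im) ∧
      (∀ T : ℝ, {i | (κ i).im ≤ T}.Finite) ∧ Summable (fun i ↦ μ i * ‖κ i‖ ^ 2) ∧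
      ∀ k : ℕ, 1 ≤ k → ∀ r : ℕ, r ≤ 2 →
        HasSum (fun i ↦ (μ i : ℂ) * conj (κ i) ^ r * Complex.exp (κ i * (((k : ℝ) * h : ℝ) : ℂ))) 0 := by
  let p : Prm := ⟨h, 1 / 4, hh, by norm_num, by norm_num⟩
  exact ⟨p.Idx, p.wt, p.kap, p.idx_nonempty, p.wt_pos, fun i ↦ ⟨p.kap_re_pos i, p.kap_re_lt i⟩,
    p.one_lt_kap_im, p.im_finite, p.mass_summable, p.blind⟩

end Summit.RiemannHypothesis.RiemannHypothesis.Theorems.TwoPrimeFoldRigidity.Negative.MBT
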